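import Mathlib
import Summits.NavierStokesRegularity.NavierStokesRegularity.Theorems.FilamentSkeletonRssDefectColumnGateDefsRmod
import Summits.NavierStokesRegularity.NavierStokesRegularity.Theorems.FilamentSkeletonRssDefectColumnGateClosingAcc

/-!
# Route `FilamentSkeletonRss` · «acc-MOD» (R8-2 shape: reduction modulo the rate mode and the accretion modes, NO export law) — STUB S3-mod
# `stub_defectClosingMod : DefectClosingMod`, PROVED (= S3-acc `stub_defectClosingAcc` p680579 minus the export transfer)

Helper file (theorems only), `--supports stmt-NavierStokesRegularity-23611 --as helper`; LEAD of 23611, lane ns-filament-21221-p1 g13.  Vocabulary `…DefsRmod` (files-only until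
tenure retypes).  HONEST FRAMING: closing step of a HYPOTHETICAL blow-up route's modulo-accretion reduction (MODEL rung, negative side); nothing here bears on NS regularity.
-/

set_option linter.dupNamespace false

noncomputable section

namespace Summit.NavierStokesRegularity.NavierStokesRegularity.Theorems.DefectColumnGate

open scoped BigOperators Topology InnerProductSpace ContDiff
open Filter Set Function MeasureTheory Metric
open Literature.Analysis.FluidPDE
open Summit.NavierStokesRegularity.NavierStokesRegularity.Theses.FilamentSkeletonRss
open Summit.NavierStokesRegularity.NavierStokesRegularity.Theorems.KelvinGate

/-- **STUB S3-mod `DefectClosingMod`, PROVED** (statement `…DefsRmod.DefectClosingMod`, by name). -/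
theorem stub_defectClosingMod : DefectClosingMod := by
  intro N δ ρ K Λ a b cnd η Rw Rb cg θ₀ KA hN hδ hρ ha hη hRw hRb hcg hθ₀ Cs κ C₂ q₀ k₀'
  refine ⟨q₀, le_rfl, max (max k₀' 1) (⌈2 * |κ| + |q₀|⌉₊ + 2), le_trans (le_max_left _ _) (le_max_left _ _),
    le_trans (le_max_right _ _) (le_max_left _ _), ?_⟩
  set k : ℕ := max (max k₀' 1) (⌈2 * |κ| + |q₀|⌉₊ + 2) with hk
  intro Cr
  refine ⟨max 1 (64 * C₂ ^ 2 * |Cr| + 4 * |C₂| * |Cr| + 4 * |C₂| * |Cr| / η + 2), ?_⟩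
  intro Γ hΓ γ α X w c m n Aa u v A T D hu hv hA hT hD hcl α0 β₀ U0 P0 Z g Gc r hfam 𝓚 𝓠 𝓫 𝓬 hgate
  classical
  have hΓ1 : 1 ≤ Γ := le_trans (le_max_left _ _) hΓ
  have hΓbig : 64 * C₂ ^ 2 * |Cr| + 4 * |C₂| * |Cr| + 4 * |C₂| * |Cr| / η + 2 ≤ Γ := le_trans (le_max_right _ _) hΓ
  have hΓ0 : 0 < Γ := by linarith
  -- the order `k`
  have hk1 : 1 ≤ k := le_trans (le_max_right _ _) (le_max_left _ _)
  have hkR : 2 * |κ| + |q₀| + 2 ≤ (k:ℝ) := by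
    have h1 : ((⌈2 * |κ| + |q₀|⌉₊ + 2 : ℕ) : ℝ) ≤ (k:ℝ) := by exact_mod_cast le_max_right (max k₀' 1) (⌈2 * |κ| + |q₀|⌉₊ + 2)
    push_cast at h1
    linarith [Nat.le_ceil (2 * |κ| + |q₀|)]
  have hk2κ : 2 * κ + 1 ≤ (k:ℝ) := by linarith [le_abs_self κ, abs_nonneg q₀]
  have hkq : κ - (k:ℝ) + q₀ ≤ -2 := by linarith [le_abs_self κ, le_abs_self q₀, abs_nonneg κ]
  -- the cube and the family facts
  set cube : Set (Fin N → ℝ) := {p : Fin N → ℝ | ∀ i, p i ∈ Icc (0:ℝ) 1} with hcube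
  obtain ⟨hβ₀, hβθ, -, hsign, hfamp⟩ := id hfam
  obtain ⟨hg12, htight, hgc⟩ := id hgate
  let p₀ : Fin N → ℝ := fun _ => 0
  have hp₀ : ∀ i, p₀ i ∈ Icc (0:ℝ) 1 := fun _ => ⟨le_rfl, zero_le_one⟩
  have habs1 : |(-β₀)| ≤ β₀ := by rw [abs_neg, abs_of_pos hβ₀]
  have habs2 : |β₀| ≤ β₀ := by rw [abs_of_pos hβ₀]
  have hres : ∀ p : Fin N → ℝ, (∀ i, p i ∈ Icc (0:ℝ) 1) → ∀ β : ℝ, |β| ≤ β₀ → YBound (r p β) (Cr * Γ ^ (-(k:ℝ))) :=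
    fun p hp β hβ => ((hfamp p hp).2.1 β hβ).2.2.2.2.2.2.2.2.2.2.1
  have hCr : 0 ≤ Cr := by
    have hε0 : 0 ≤ Cr * Γ ^ (-(k:ℝ)) := (hres p₀ hp₀ β₀ habs2).nonneg
    have hpos : 0 < Γ ^ (-(k:ℝ)) := Real.rpow_pos_of_pos hΓ0 _
    by_contra hneg
    push Not at hneg
    have : Cr * Γ ^ (-(k:ℝ)) < 0 := mul_neg_of_neg_of_pos hneg hpos
    linarith
  obtain ⟨h64, hhalf, hηΓ, hbq⟩ := closing_thresholds hΓ1 hk2κ hk1 hkq hη hCr hΓbig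
  set ε : ℝ := Cr * Γ ^ (-(k:ℝ)) with hε
  set Ag : ℝ := C₂ * Γ ^ κ with hAg
  have hε0 : 0 ≤ ε := (hres p₀ hp₀ β₀ habs2).nonneg
  have h16 : 16 * Ag ^ 2 * ε ≤ 1 := by nlinarith [sq_nonneg Ag]
  have hhalf' : 2 * Ag * ε ≤ 1 / 2 := by rw [hAg, hε]; linarith
  have hηΓ' : 2 * Ag * ε ≤ η * √Γ / 2 := by rw [hAg, hε]; linarith
  -- gate clauses (1) and (2), split
  have hK1 : ∀ p : Fin N → ℝ, (∀ i, p i ∈ Icc (0:ℝ) 1) → ∀ β : ℝ, |β| ≤ β₀ → ∀ (F : EuclideanSpace ℝ (Fin 3) → EuclideanSpace ℝ (Fin 3)) (R : ℝ), YBound F R →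
      XBound (𝓚 p β F) (Ag * R) := fun p hp β hβ F R hF => ((hg12 p hp β hβ).1 F R hF).1
  have hK2 : ∀ p : Fin N → ℝ, (∀ i, p i ∈ Icc (0:ℝ) 1) → ∀ β : ℝ, |β| ≤ β₀ → ∀ (F G : EuclideanSpace ℝ (Fin 3) → EuclideanSpace ℝ (Fin 3)) (s : ℝ), (∃ R, YBound F R) →
      (∃ R, YBound G R) → 𝓚 p β (fun y => F y + s • G y) = fun y => 𝓚 p β F y + s • 𝓚 p β G y :=
    fun p hp β hβ F G s hF hG => ((hg12 p hp β hβ).2 F G s hF hG).1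
  have hA0 : 0 ≤ Ag := by
    have h := (hK1 p₀ hp₀ β₀ habs2 (fun _ => 0) 1 (yBound_zero.mono zero_le_one)).nonneg
    linarith
  -- per-(p,β) frozen Picard
  have hpic : ∀ p : Fin N → ℝ, (∀ i, p i ∈ Icc (0:ℝ) 1) → ∀ β : ℝ, |β| ≤ β₀ → ∃ F : EuclideanSpace ℝ (Fin 3) → EuclideanSpace ℝ (Fin 3),
      YBound F (2 * ε) ∧ ∀ y, F y = -r p β y - fderiv ℝ (𝓚 p β F) y (𝓚 p β F y) :=
    fun p hp β hβ => picard_exists_fixedPoint (K := 𝓚 p β) (A := Ag) (hK1 p hp β hβ) (hK2 p hp β hβ) (hres p hp β hβ) h16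
  choose! G hG using hpic
  -- bounds on the multipliers of the fixed-point forcing
  have hbB : ∀ p : Fin N → ℝ, (∀ i, p i ∈ Icc (0:ℝ) 1) → ∀ β : ℝ, |β| ≤ β₀ → |𝓫 p β (G p β)| ≤ Ag * (2 * ε) :=
    fun p hp β hβ => ((hg12 p hp β hβ).1 (G p β) _ (hG p hp β hβ).1).2.2.2.1
  have hcB : ∀ p : Fin N → ℝ, (∀ i, p i ∈ Icc (0:ℝ) 1) → ∀ β : ℝ, |β| ≤ β₀ → ∀ j, |𝓬 p β (G p β) j| ≤ Ag * (2 * ε) :=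
    fun p hp β hβ j => ((hg12 p hp β hβ).1 (G p β) _ (hG p hp β hβ).1).2.2.2.2.1 j
  have hbq' : ∀ p : Fin N → ℝ, (∀ i, p i ∈ Icc (0:ℝ) 1) → ∀ β : ℝ, |β| ≤ β₀ → |𝓫 p β (G p β)| < Γ ^ (-q₀) :=
    fun p hp β hβ => lt_of_le_of_lt (hbB p hp β hβ) hbq
  -- the orientation sign
  set σ : ℝ := if (∀ p : Fin N → ℝ, (∀ i, p i ∈ Icc (0:ℝ) 1) → g p (-β₀) ≤ -Γ ^ (-q₀) ∧ Γ ^ (-q₀) ≤ g p β₀) then 1 else -1 with hσdef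
  have hσ : σ * σ = 1 := by
    rw [hσdef]; split_ifs <;> norm_num
  -- the window rescaling
  have hwin : ∀ b' : ℝ, b' ∈ Icc (-1:ℝ) 1 → |β₀ * b'| ≤ β₀ := by
    intro b' hb'
    rw [abs_mul, abs_of_pos hβ₀]
    have : |b'| ≤ 1 := abs_le.mpr ⟨hb'.1, hb'.2⟩
    nlinarith
  -- THE OUTPUTS
  refine ⟨Cs * Γ ^ 4 + 2 * Ag * ε, Cs * Γ ^ 4 + 2 * Ag * ε, fun p b' => α0 p + β₀ * b',
    fun p b' => σ * (g p (β₀ * b') - 𝓫 p (β₀ * b') (G p (β₀ * b'))),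
    fun p b' j => Gc p (β₀ * b') j - 𝓬 p (β₀ * b') (G p (β₀ * b')) j,
    fun p b' y => σ • Z p (β₀ * b') y, fun p b' y => U0 p (β₀ * b') y + 𝓚 p (β₀ * b') (G p (β₀ * b')) y,
    fun p b' y => P0 p (β₀ * b') y + 𝓠 p (β₀ * b') (G p (β₀ * b')) y, ?_, ?_, ?_⟩
  · /- JOINT CONTINUITY of `(g', B)` on `cube ×ˢ [−1, 1]`: first on the physical parameter set `S = cube ×ˢ [−β₀, β₀]`, then pulled back
       along `(p, b) ↦ (p, β₀b)`. -/
    set S : Set ((Fin N → ℝ) × ℝ) := cube ×ˢ Icc (-β₀) β₀ with hS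
    have hSm : ∀ π : (Fin N → ℝ) × ℝ, π ∈ S → (∀ i, π.1 i ∈ Icc (0:ℝ) 1) ∧ |π.2| ≤ β₀ := fun π hπ => (mem_cubeWindow_iff π).mp hπ
    -- the abstract continuity theorem's hypotheses, on `S`
    have aK1 : ∀ π ∈ S, ∀ (F : EuclideanSpace ℝ (Fin 3) → EuclideanSpace ℝ (Fin 3)) (R : ℝ), YBound F R → XBound (𝓚 π.1 π.2 F) (Ag * R) :=
      fun π hπ => hK1 π.1 (hSm π hπ).1 π.2 (hSm π hπ).2
    have aK2 : ∀ π ∈ S, ∀ (F G : EuclideanSpace ℝ (Fin 3) → EuclideanSpace ℝ (Fin 3)) (s : ℝ), (∃ R, YBound F R) → (∃ R, YBound G R) →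
        𝓚 π.1 π.2 (fun y => F y + s • G y) = fun y => 𝓚 π.1 π.2 F y + s • 𝓚 π.1 π.2 G y :=
      fun π hπ => hK2 π.1 (hSm π hπ).1 π.2 (hSm π hπ).2
    have aK3 : ∀ R L t : ℝ, 0 < t → ∃ L' δ₀ : ℝ, 0 < δ₀ ∧ ∀ π ∈ S, ∀ F : EuclideanSpace ℝ (Fin 3) → EuclideanSpace ℝ (Fin 3),
        YBound F R → (∀ y, ‖y‖ ≤ L' → ‖F y‖ ≤ δ₀) → ∀ y, ‖y‖ ≤ L → ‖𝓚 π.1 π.2 F y‖ ≤ t ∧ ‖fderiv ℝ (𝓚 π.1 π.2 F) y‖ ≤ t := by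
      intro R L t ht
      obtain ⟨L', δ₀, hδ₀, h3⟩ := htight R L t ht
      exact ⟨L', δ₀, hδ₀, fun π hπ F hF hsm => (h3 π.1 (hSm π hπ).1 π.2 (hSm π hπ).2 F hF hsm).1⟩
    have aK4 : ∀ π ∈ S, ∀ (F : EuclideanSpace ℝ (Fin 3) → EuclideanSpace ℝ (Fin 3)) (R L t : ℝ), YBound F R → 0 < t →
        ∃ δ' > 0, ∀ π' ∈ S, dist π' π < δ' → LocClose (𝓚 π'.1 π'.2 F) (𝓚 π.1 π.2 F) L t := by
      intro π hπ F R L t hF ht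
      obtain ⟨δ', hδ', h4⟩ := hgc π.1 (hSm π hπ).1 π.2 (hSm π hπ).2 F R L t hF ht
      exact ⟨δ', hδ', fun π' hπ' hd => (h4 π'.1 (hSm π' hπ').1 π'.2 (hSm π' hπ').2 (dist_cubeWindow_lt hd).1 (dist_cubeWindow_lt hd).2).1⟩
    have ares : ∀ π ∈ S, YBound (r π.1 π.2) ε := fun π hπ => hres π.1 (hSm π hπ).1 π.2 (hSm π hπ).2
    have arc : ∀ π ∈ S, ∀ L t : ℝ, 0 < t → ∃ δ' > 0, ∀ π' ∈ S, dist π' π < δ' → ∀ y, ‖y‖ ≤ L → ‖r π'.1 π'.2 y - r π.1 π.2 y‖ ≤ t := by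
      intro π hπ L t ht
      obtain ⟨δ', hδ', hc⟩ := (hfamp π.1 (hSm π hπ).1).2.2 π.2 (hSm π hπ).2 L t ht
      exact ⟨δ', hδ', fun π' hπ' hd => (hc π'.1 (hSm π' hπ').1 π'.2 (hSm π' hπ').2 (dist_cubeWindow_lt hd).1 (dist_cubeWindow_lt hd).2).2.2.1⟩
    have aG : ∀ π ∈ S, YBound (G π.1 π.2) (2 * ε) ∧ ∀ y, G π.1 π.2 y = -r π.1 π.2 y - fderiv ℝ (𝓚 π.1 π.2 (G π.1 π.2)) y (𝓚 π.1 π.2 (G π.1 π.2) y) :=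
      fun π hπ => hG π.1 (hSm π hπ).1 π.2 (hSm π hπ).2
    -- (i) `π ↦ 𝓫_π G_π` is continuous on `S`
    have hcb : ContinuousOn (fun π : (Fin N → ℝ) × ℝ => 𝓫 π.1 π.2 (G π.1 π.2)) S := by
      refine continuousOn_functional_fixedPoint (S := S) (r := fun π => r π.1 π.2) (𝓚 := fun π => 𝓚 π.1 π.2) (ℓ := fun π => 𝓫 π.1 π.2)
        (G := fun π => G π.1 π.2) aK1 aK2 aK3 aK4 ares arc h16 hA0 ?_ ?_ ?_ ?_ aG
      · exact fun π hπ F R hF => ((hg12 π.1 (hSm π hπ).1 π.2 (hSm π hπ).2).1 F R hF).2.2.2.1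
      · exact fun π hπ F H s hF hH => ((hg12 π.1 (hSm π hπ).1 π.2 (hSm π hπ).2).2 F H s hF hH).2.1
      · intro R t ht
        obtain ⟨L', δ₀, hδ₀, h3⟩ := htight R 0 t ht
        exact ⟨L', δ₀, hδ₀, fun π hπ F hF hsm => (h3 π.1 (hSm π hπ).1 π.2 (hSm π hπ).2 F hF hsm).2.1⟩
      · intro π hπ F R t hF ht
        obtain ⟨δ', hδ', h4⟩ := hgc π.1 (hSm π hπ).1 π.2 (hSm π hπ).2 F R 0 t hF ht
        exact ⟨δ', hδ', fun π' hπ' hd => (h4 π'.1 (hSm π' hπ').1 π'.2 (hSm π' hπ').2 (dist_cubeWindow_lt hd).1 (dist_cubeWindow_lt hd).2).2.1⟩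
    -- (ii) `π ↦ 𝓬_π G_π j` is continuous on `S` for every `j`
    have hcc : ∀ j, ContinuousOn (fun π : (Fin N → ℝ) × ℝ => 𝓬 π.1 π.2 (G π.1 π.2) j) S := by
      intro j
      refine continuousOn_functional_fixedPoint (S := S) (r := fun π => r π.1 π.2) (𝓚 := fun π => 𝓚 π.1 π.2) (ℓ := fun π F => 𝓬 π.1 π.2 F j)
        (G := fun π => G π.1 π.2) aK1 aK2 aK3 aK4 ares arc h16 hA0 ?_ ?_ ?_ ?_ aG
      · exact fun π hπ F R hF => ((hg12 π.1 (hSm π hπ).1 π.2 (hSm π hπ).2).1 F R hF).2.2.2.2.1 j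
      · exact fun π hπ F H s hF hH => ((hg12 π.1 (hSm π hπ).1 π.2 (hSm π hπ).2).2 F H s hF hH).2.2 j
      · intro R t ht
        obtain ⟨L', δ₀, hδ₀, h3⟩ := htight R 0 t ht
        exact ⟨L', δ₀, hδ₀, fun π hπ F hF hsm => (h3 π.1 (hSm π hπ).1 π.2 (hSm π hπ).2 F hF hsm).2.2 j⟩
      · intro π hπ F R t hF ht
        obtain ⟨δ', hδ', h4⟩ := hgc π.1 (hSm π hπ).1 π.2 (hSm π hπ).2 F R 0 t hF ht
        exact ⟨δ', hδ', fun π' hπ' hd => (h4 π'.1 (hSm π' hπ').1 π'.2 (hSm π' hπ').2 (dist_cubeWindow_lt hd).1 (dist_cubeWindow_lt hd).2).2.2 j⟩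
    -- (iii) `g` and `G_j` are continuous on `S` (family's joint local continuity)
    have hcg : ContinuousOn (fun π : (Fin N → ℝ) × ℝ => g π.1 π.2) S := by
      rw [Metric.continuousOn_iff]
      intro π hπ t ht
      obtain ⟨δ', hδ', hc⟩ := (hfamp π.1 (hSm π hπ).1).2.2 π.2 (hSm π hπ).2 0 (t / 2) (by positivity)
      refine ⟨δ', hδ', fun π' hπ' hd => ?_⟩
      have h := (hc π'.1 (hSm π' hπ').1 π'.2 (hSm π' hπ').2 (dist_cubeWindow_lt hd).1 (dist_cubeWindow_lt hd).2).2.2.2.1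
      rw [Real.dist_eq]; linarith
    have hcG : ∀ j, ContinuousOn (fun π : (Fin N → ℝ) × ℝ => Gc π.1 π.2 j) S := by
      intro j
      rw [Metric.continuousOn_iff]
      intro π hπ t ht
      obtain ⟨δ', hδ', hc⟩ := (hfamp π.1 (hSm π hπ).1).2.2 π.2 (hSm π hπ).2 0 (t / 2) (by positivity)
      refine ⟨δ', hδ', fun π' hπ' hd => ?_⟩
      have h := (hc π'.1 (hSm π' hπ').1 π'.2 (hSm π' hπ').2 (dist_cubeWindow_lt hd).1 (dist_cubeWindow_lt hd).2).2.2.2.2 j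
      rw [Real.dist_eq]; linarith
    -- (iv) assemble on `S`, then pull back along the rescaling
    have hΦ : ContinuousOn (fun π : (Fin N → ℝ) × ℝ => (σ * (g π.1 π.2 - 𝓫 π.1 π.2 (G π.1 π.2)),
        fun j => Gc π.1 π.2 j - 𝓬 π.1 π.2 (G π.1 π.2) j)) S :=
      (continuousOn_const.mul (hcg.sub hcb)).prodMk (continuousOn_pi.2 fun j => (hcG j).sub (hcc j))
    have hψ : Continuous fun q : (Fin N → ℝ) × ℝ => ((q.1, β₀ * q.2) : (Fin N → ℝ) × ℝ) :=
      continuous_fst.prodMk (continuous_const.mul continuous_snd)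
    have hψm : MapsTo (fun q : (Fin N → ℝ) × ℝ => ((q.1, β₀ * q.2) : (Fin N → ℝ) × ℝ)) (cube ×ˢ Icc (-1) 1) S := by
      intro q hq
      rw [mem_prod] at hq
      refine (mem_cubeWindow_iff _).mpr ⟨hq.1, hwin q.2 hq.2⟩
    exact hΦ.comp hψ.continuousOn hψm
  · -- RATE FACES
    intro p hp
    have e1 : β₀ * (-1:ℝ) = -β₀ := mul_neg_one β₀
    have e2 : β₀ * (1:ℝ) = β₀ := mul_one β₀
    simp only [e1, e2]
    have hb1 := abs_lt.mp (hbq' p hp (-β₀) habs1)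
    have hb2 := abs_lt.mp (hbq' p hp β₀ habs2)
    by_cases hor : ∀ p : Fin N → ℝ, (∀ i, p i ∈ Icc (0:ℝ) 1) → g p (-β₀) ≤ -Γ ^ (-q₀) ∧ Γ ^ (-q₀) ≤ g p β₀
    · have hσ1 : σ = 1 := by rw [hσdef, if_pos hor]
      obtain ⟨h1, h2⟩ := hor p hp
      rw [hσ1]; constructor <;> linarith
    · have hσ1 : σ = -1 := by rw [hσdef, if_neg hor]
      obtain ⟨h1, h2⟩ := (hsign.resolve_left hor) p hp
      rw [hσ1]; constructor <;> linarith
  · -- THE BLOCK AT EVERY `(p, b)`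
    intro p b' hp hb'
    set β : ℝ := β₀ * b' with hβdef
    have hβ : |β| ≤ β₀ := hwin b' hb'
    obtain ⟨hU0s, hP0s, hdiv0, hU0X, hP0b, hy₀, hwaist, -, -, -, -, -, hresEq⟩ := (hfamp p hp).2.1 β hβ
    obtain ⟨hW, hQ1, hQb, -, -, hdivW, heq⟩ := (hg12 p hp β hβ).1 (G p β) _ (hG p hp β hβ).1
    -- the rate `αo = α⁰_p + β₀ b` is nonzero
    have hα₁ : α0 p + β ≠ 0 := by
      have hθα : θ₀ ≤ |α p| := (hcl.2 p hp).2.2.2.2.2.2.2.2.2.2.1.1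
      have hα0 : |α0 p - α p| ≤ θ₀ / 4 := (hfamp p hp).1
      intro h0
      have hα0eq : α0 p = -β := eq_neg_of_add_eq_zero_left h0
      have h1 : |α p| ≤ |α p - α0 p| + |α0 p| := by
        calc |α p| = |(α p - α0 p) + α0 p| := by congr 1; ring
          _ ≤ |α p - α0 p| + |α0 p| := abs_add_le _ _
      rw [abs_sub_comm] at h1
      rw [hα0eq, abs_neg] at h1
      rw [hα0eq] at hα0
      linarith [hβ.trans hβθ]
    obtain ⟨hne, hU2, hP1, hdiv, heqn, hdec, hPM, hwin'⟩ :=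
      boxConcl_point_of_fixedPoint (σ := σ) hU0s hP0s hdiv0 hU0X hP0b hy₀ hwaist hresEq hW hQ1 hQb hdivW heq (hG p hp β hβ).2 hσ
        (by rw [hAg, hε] at hhalf'; linarith) (by rw [hAg, hε] at hηΓ'; linarith)
    refine ⟨hα₁, hne, hU2, hP1, hdiv, fun y => heqn y, fun y => ?_, fun y => ?_, hwin'⟩
    · have := hdec y; rw [hAg, hε] at this ⊢; exact this
    · have := hPM y; rw [hAg, hε] at this ⊢; exact this

end Summit.NavierStokesRegularity.NavierStokesRegularity.Theorems.DefectColumnGate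

end
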